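import Summits.BirchSwinnertonDyer.BirchSwinnertonDyer.Theorems.ManinLocalTwoThreeMinimalCubeRootIntegral
import Summits.BirchSwinnertonDyer.Rank1Residual.ManinAdditive.UDCKummerLineK
import HarnessLib

/-!
# (INT)_K, transport: `Θ_T = ρ³·Θ^{min}` over `ℂ` and the renormalisation `ρ⁻¹ ∈ 1 + qℚ⟦q⟧`
(route `ManinLocalTwoThree`, crux C3 `ManinPrimeToThreeAtNine` stmt-BirchSwinnertonDyer-22968; cell bsd-f2-manin, prover seat p3 gen 16 —
piece (INT)_K of -an g39's `K`-rational UDC line `UDCKummerLineK`, p2 g18's interface; `--supports` 22968)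

For a `K`-point `T = (X₀, Y₀)`, `X₀ ∈ ℚ`, `Y₀ ∈ ℂ` (an's `kummerCubeSeriesC`, `tangentSlopeC`), the short germ `z` (`IsParamGerm`) and the
minimal germ `z_W = exp_W(c·Σaₙqⁿ/n)`:

* `exists_rhoInv` — the RATIONAL series `R = ρ⁻¹` (`= (X_W − (a₁/2)z_W X_W − (a₃/2)z_W³)·(X_W + (b₂/12)z_W²)⁻¹`): `R(0) = 1`, `c·z·R = z_W`
  (`T`-free; from `…ShortGermTransport.shortGerm_mul_eq'`).
* `kummerCubeSeriesC_mul_cube_eq` — `Θ_T·z_W³ = (cz)³·Θ^{min}_T(z_W)` in `ℂ⟦q⟧`, `Θ^{min}_T(t) = Y_W(t) − y_T t³ − λ(X_W(t)t − x_T t³)` with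
  `x_T = X₀/c² − b₂/12`, `y_T = Y₀/c³ − (a₁x_T + a₃)/2`, `λ = α/c − a₁/2` (the two RATIONAL identities of `…ShortGermTransport` mapped to `ℂ`).
* `rhoInv_pow_mul_kummerCubeSeriesC` — `R³·Θ_T = Θ^{min}_T(z_W)`; hence for a cube root `h` of `Θ_T`, `g := R·h` has `g³ = Θ^{min}_T(z_W)`,
  `g(0) = −h(0)…`, `c·z·g = z_W·h` (`exists_minimalCubeRootC`).

HONEST FRAMING.  Formal-group algebra only; nothing about (INT)_K's integrality conclusion, C3, Manin's conjecture or BSD is proved here.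
No definitions, no sorry. [cite: SilvermanAEC2009, III.1 and IV.1 (changes of variables; formal group expansions)]
-/

set_option autoImplicit false
-- lint-debt: the directory name repeats the summit name (sibling precedent `ManinLocalTwoThreeMinimalCubeRootIntegral.lean`)
set_option linter.dupNamespace false

noncomputable section

open scoped Classical
open PowerSeries WeierstrassCurve Literature.NumberTheory.EllipticCurves Literature.NumberTheory.EllipticCurves.ModularForms
open Summit.BirchSwinnertonDyer.Rank1Residual.ManinAdditive.CuspidalKummer
open Summit.BirchSwinnertonDyer.Rank1Residual.ManinAdditive.CuspidalKummerThree
open Summit.BirchSwinnertonDyer.Rank1Residual.ManinAdditive.UDCKummerLineK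
open Summit.BirchSwinnertonDyer.BirchSwinnertonDyer.Theorems.ManinLocalTwoThree.ShortGermTransport

namespace Summit.BirchSwinnertonDyer.BirchSwinnertonDyer.Theorems.ManinLocalTwoThree.MinimalCubeRootC

/-! ## §1 `ρ⁻¹` -/

/-- **The renormalisation `R = ρ⁻¹ ∈ 1 + qℚ⟦q⟧` with `c·z·R = z_W`** (`T`-free). [cite: SilvermanAEC2009, III.1 and IV.1] -/
theorem exists_rhoInv (W : WeierstrassCurve ℚ) {c : ℤ} (hc : c ≠ 0) (a : ℕ → ℤ) {z : ℚ⟦X⟧} (hz : IsParamGerm W c a z) :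
    ∃ R : ℚ⟦X⟧, constantCoeff R = 1 ∧ C (c : ℚ) * z * R = W.formalExp.subst ((c : ℚ) • lSeriesLog a) := by
  set L := lSeriesLog a with hL
  set zW := W.formalExp.subst ((c : ℚ) • L) with hzW
  have hcL0 : constantCoeff ((c : ℚ) • L) = 0 := constantCoeff_smul_lSeriesLog c a
  have hzW0 : constantCoeff zW = 0 := constantCoeff_formalExp_subst W hcL0
  set P := W.formalXMulSq.subst zW with hP
  have hP0 : constantCoeff P = 1 := by rw [hP, constantCoeff_subst_eq_constantCoeff hzW0, constantCoeff_formalXMulSq]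
  have hθ := shortGerm_mul_eq' W hc a hz
  rw [← hL, ← hzW, ← hP] at hθ
  set U : ℚ⟦X⟧ := P + C (W.b₂ / 12) * zW ^ 2 with hU
  set D' : ℚ⟦X⟧ := P - C (W.a₁ / 2) * zW * P - C (W.a₃ / 2) * zW ^ 3 with hD'
  have hU0 : constantCoeff U = 1 := by simp [hU, hP0, hzW0]
  have hD'0 : constantCoeff D' = 1 := by simp [hD', hP0, hzW0]
  set Ui : ℚ⟦X⟧ := PowerSeries.invOfUnit U 1 with hUi
  have hUUi : U * Ui = 1 := by
    rw [hUi]; exact PowerSeries.mul_invOfUnit U 1 (by rw [hU0, Units.val_one])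
  have hθ' : C (c : ℚ) * z * D' = zW * U := by rw [hD', hU]; linear_combination hθ
  have hUi0 : constantCoeff Ui = 1 := by
    have := congrArg constantCoeff hUUi
    rw [map_mul, hU0, one_mul, map_one] at this
    exact this
  refine ⟨D' * Ui, by rw [map_mul, hD'0, hUi0, one_mul], ?_⟩
  linear_combination Ui * hθ' + zW * hUUi

/-! ## §2 `Θ_T·z_W³ = (cz)³·Θ^{min}_T(z_W)` over `ℂ` -/

section Transport

variable (W : WeierstrassCurve ℚ) {c : ℤ} (hc : c ≠ 0) (a : ℕ → ℤ) {z : ℚ⟦X⟧} (hz : IsParamGerm W c a z)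
include hc hz

/-- **The line series on the two models, over `ℂ`** (free scalars `x₁ y₁ l₁ ∈ ℂ`; `X₁ = c²(x₁ + b₂/12)`, `Y₁ = c³(y₁ + (a₁/2)x₁ + a₃/2)`,
`α₁ = c(l₁ + a₁/2)`): the two RATIONAL transport identities of `…ShortGermTransport` mapped to `ℂ⟦q⟧`. [cite: SilvermanAEC2009, III.1 and IV.1] -/
theorem lineSeriesC_mul_cube_eq (x₁ y₁ l₁ : ℂ) :
    (PowerSeries.map (algebraMap ℚ ℂ) ((shortModel W c).formalYMulCube.subst z)
        - C ((c : ℂ) ^ 3 * (y₁ + (W.a₁ : ℂ) / 2 * x₁ + (W.a₃ : ℂ) / 2)) * PowerSeries.map (algebraMap ℚ ℂ) z ^ 3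
        - C ((c : ℂ) * (l₁ + (W.a₁ : ℂ) / 2))
          * (PowerSeries.map (algebraMap ℚ ℂ) ((shortModel W c).formalXMulSq.subst z) * PowerSeries.map (algebraMap ℚ ℂ) z
            - C ((c : ℂ) ^ 2 * (x₁ + (W.b₂ : ℂ) / 12)) * PowerSeries.map (algebraMap ℚ ℂ) z ^ 3))
        * PowerSeries.map (algebraMap ℚ ℂ) (W.formalExp.subst ((c : ℚ) • lSeriesLog a)) ^ 3 =
      (C (c : ℂ) * PowerSeries.map (algebraMap ℚ ℂ) z) ^ 3 *
        (PowerSeries.map (algebraMap ℚ ℂ) (W.formalYMulCube.subst (W.formalExp.subst ((c : ℚ) • lSeriesLog a)))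
          - C y₁ * PowerSeries.map (algebraMap ℚ ℂ) (W.formalExp.subst ((c : ℚ) • lSeriesLog a)) ^ 3
          - C l₁ * (PowerSeries.map (algebraMap ℚ ℂ) (W.formalXMulSq.subst (W.formalExp.subst ((c : ℚ) • lSeriesLog a)))
                  * PowerSeries.map (algebraMap ℚ ℂ) (W.formalExp.subst ((c : ℚ) • lSeriesLog a))
              - C x₁ * PowerSeries.map (algebraMap ℚ ℂ) (W.formalExp.subst ((c : ℚ) • lSeriesLog a)) ^ 3)) := by
  have hc' : (c : ℚ) ≠ 0 := by exact_mod_cast hc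
  set vc : VariableChange ℚ := ⟨Units.mk0 ((c : ℚ)⁻¹) (inv_ne_zero hc'), -(W.b₂ / 12), -(W.a₁ / 2),
    W.a₁ * W.b₂ / 24 - W.a₃ / 2⟩ with hvc
  set φ := algebraMap ℚ ℂ with hφ
  set L := lSeriesLog a with hL
  set zW := W.formalExp.subst ((c : ℚ) • L) with hzW
  have hcL0 : constantCoeff ((c : ℚ) • L) = 0 := constantCoeff_smul_lSeriesLog c a
  have hzW0 : constantCoeff zW = 0 := constantCoeff_formalExp_subst W hcL0
  -- the two rational identities, mapped to `ℂ`
  have hI := congrArg (PowerSeries.map φ) (formalXMulSq_shortGerm_mul_sq W hc vc (by rw [hvc, Units.val_mk0]) rfl rfl rfl a hz)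
  have hθ := congrArg (PowerSeries.map φ) (shortGerm_mul_eq' W hc a hz)
  rw [← hL, ← hzW] at hI hθ
  rw [formalYMulCube_subst_eq_neg (shortModel W c) hz.1, formalYMulCube_subst_eq_neg W hzW0]
  set S := (shortModel W c).formalXMulSq.subst z with hS
  set P := W.formalXMulSq.subst zW with hP
  have hφc : φ (c : ℚ) = (c : ℂ) := by rw [hφ]; rfl
  have hφb : φ (W.b₂ / 12) = (W.b₂ : ℂ) / 12 := by rw [hφ]; push_cast; rfl
  have hφa₁ : φ (W.a₁ / 2) = (W.a₁ : ℂ) / 2 := by rw [hφ]; push_cast; rfl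
  have hφa₃ : φ (W.a₃ / 2) = (W.a₃ : ℂ) / 2 := by rw [hφ]; push_cast; rfl
  simp only [map_mul, map_add, map_sub, map_pow, PowerSeries.map_C, hφc, hφb, hφa₁, hφa₃] at hI hθ
  simp only [map_neg, map_mul, map_add, map_pow]
  set z' := PowerSeries.map φ z
  set zW' := PowerSeries.map φ zW
  set S' := PowerSeries.map φ S
  set P' := PowerSeries.map φ P
  linear_combination (-(zW' * (1 + C (c : ℂ) * (C l₁ + C ((W.a₁ : ℂ) / 2)) * z'))) * hI + (C (c : ℂ) ^ 2 * z' ^ 2) * hθ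

omit hc hz in
/-- an's `kummerCubeSeriesC`, with the scalars pulled out as `C`-constants. [folklore] -/
theorem kummerCubeSeriesC_eq (X₀ : ℚ) (Y₀ : ℂ) :
    kummerCubeSeriesC W c X₀ Y₀ z =
      PowerSeries.map (algebraMap ℚ ℂ) ((shortModel W c).formalYMulCube.subst z)
        - C Y₀ * PowerSeries.map (algebraMap ℚ ℂ) z ^ 3
        - C (tangentSlopeC W c X₀ Y₀)
          * (PowerSeries.map (algebraMap ℚ ℂ) ((shortModel W c).formalXMulSq.subst z) * PowerSeries.map (algebraMap ℚ ℂ) z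
            - C (X₀ : ℂ) * PowerSeries.map (algebraMap ℚ ℂ) z ^ 3) := by
  rw [kummerCubeSeriesC, smul_eq_C_mul, smul_eq_C_mul, smul_eq_C_mul, map_sub, map_mul, map_mul, map_pow, PowerSeries.map_C,
    eq_ratCast]

/-- **`Θ_T·z_W³ = (cz)³·Θ^{min}_T(z_W)` over `ℂ`** for the `K`-point `T = (X₀, Y₀)`: `x_T = X₀/c² − b₂/12`, `y_T = Y₀/c³ − (a₁x_T + a₃)/2`,
`λ = α/c − a₁/2`. [cite: SilvermanAEC2009, III.1 and IV.1] -/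
theorem kummerCubeSeriesC_mul_cube_eq (X₀ : ℚ) (Y₀ : ℂ) :
    kummerCubeSeriesC W c X₀ Y₀ z * PowerSeries.map (algebraMap ℚ ℂ) (W.formalExp.subst ((c : ℚ) • lSeriesLog a)) ^ 3 =
      (C (c : ℂ) * PowerSeries.map (algebraMap ℚ ℂ) z) ^ 3 *
        (PowerSeries.map (algebraMap ℚ ℂ) (W.formalYMulCube.subst (W.formalExp.subst ((c : ℚ) • lSeriesLog a)))
          - C (Y₀ / (c : ℂ) ^ 3 - ((W.a₁ : ℂ) * ((X₀ / (c : ℚ) ^ 2 - W.b₂ / 12 : ℚ) : ℂ) + W.a₃) / 2)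
              * PowerSeries.map (algebraMap ℚ ℂ) (W.formalExp.subst ((c : ℚ) • lSeriesLog a)) ^ 3
          - C (tangentSlopeC W c X₀ Y₀ / c - (W.a₁ : ℂ) / 2)
              * (PowerSeries.map (algebraMap ℚ ℂ) (W.formalXMulSq.subst (W.formalExp.subst ((c : ℚ) • lSeriesLog a)))
                  * PowerSeries.map (algebraMap ℚ ℂ) (W.formalExp.subst ((c : ℚ) • lSeriesLog a))
                - C (((X₀ / (c : ℚ) ^ 2 - W.b₂ / 12 : ℚ) : ℂ))
                  * PowerSeries.map (algebraMap ℚ ℂ) (W.formalExp.subst ((c : ℚ) • lSeriesLog a)) ^ 3)) := by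
  have hcC : (c : ℂ) ≠ 0 := by exact_mod_cast hc
  set x : ℂ := ((X₀ / (c : ℚ) ^ 2 - W.b₂ / 12 : ℚ) : ℂ) with hx
  set yT : ℂ := Y₀ / (c : ℂ) ^ 3 - ((W.a₁ : ℂ) * x + W.a₃) / 2 with hyT
  set lam : ℂ := tangentSlopeC W c X₀ Y₀ / c - (W.a₁ : ℂ) / 2 with hlam
  have hX : (c : ℂ) ^ 2 * (x + (W.b₂ : ℂ) / 12) = X₀ := by rw [hx]; push_cast; field_simp; ring
  have hY : (c : ℂ) ^ 3 * (yT + (W.a₁ : ℂ) / 2 * x + (W.a₃ : ℂ) / 2) = Y₀ := by rw [hyT]; field_simp; ring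
  have hα : (c : ℂ) * (lam + (W.a₁ : ℂ) / 2) = tangentSlopeC W c X₀ Y₀ := by rw [hlam]; field_simp; ring
  have h := lineSeriesC_mul_cube_eq W hc a hz x yT lam
  rw [hX, hY, hα] at h
  rw [kummerCubeSeriesC_eq]
  exact h

end Transport

/-! ## §3 `g = ρ⁻¹h`: `g³ = Θ^{min}_T(z_W)`, `c·z·g = z_W·h`, `g(0) = −1` -/

/-- **The renormalised cube root on the minimal model** (no integrality yet): for a cube root `h` of `Θ_T` with `h(0) = −1` there is
`g = R·h` (`R = ρ⁻¹ ∈ 1 + qℚ⟦q⟧` RATIONAL and `T`-free) with `g(0) = −1`, `c·(z·g) = z_W·h` and `g³ = Θ^{min}_T(z_W)`.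
[cite: SilvermanAEC2009, III.1 and IV.1] -/
theorem exists_minimalCubeRootC (W : WeierstrassCurve ℚ) [W.IsElliptic] {N : ℕ} [NeZero N] (D : ModularParametrizationData W N)
    (a : ℕ → ℤ) (ha : ∀ n, (a n : ℂ) = cuspCoeff D.f n) (X₀ : ℚ) (Y₀ : ℂ) {z : ℚ⟦X⟧} (hz : IsParamGerm W D.c a z)
    (h : ℂ⟦X⟧) (hh3 : h ^ 3 = kummerCubeSeriesC W D.c X₀ Y₀ z) (hh0 : constantCoeff h = -1) :
    ∃ (R : ℚ⟦X⟧), constantCoeff R = 1 ∧ C (D.c : ℚ) * z * R = W.formalExp.subst ((D.c : ℚ) • lSeriesLog a) ∧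
      constantCoeff (PowerSeries.map (algebraMap ℚ ℂ) R * h) = -1 ∧
      (D.c : ℂ) • (PowerSeries.map (algebraMap ℚ ℂ) z * (PowerSeries.map (algebraMap ℚ ℂ) R * h)) =
        PowerSeries.map (algebraMap ℚ ℂ) (W.formalExp.subst ((D.c : ℚ) • lSeriesLog a)) * h ∧
      (PowerSeries.map (algebraMap ℚ ℂ) R * h) ^ 3 =
        PowerSeries.map (algebraMap ℚ ℂ) (W.formalYMulCube.subst (W.formalExp.subst ((D.c : ℚ) • lSeriesLog a)))
          - C (Y₀ / (D.c : ℂ) ^ 3 - ((W.a₁ : ℂ) * ((X₀ / (D.c : ℚ) ^ 2 - W.b₂ / 12 : ℚ) : ℂ) + W.a₃) / 2)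
              * PowerSeries.map (algebraMap ℚ ℂ) (W.formalExp.subst ((D.c : ℚ) • lSeriesLog a)) ^ 3
          - C (tangentSlopeC W D.c X₀ Y₀ / D.c - (W.a₁ : ℂ) / 2)
              * (PowerSeries.map (algebraMap ℚ ℂ) (W.formalXMulSq.subst (W.formalExp.subst ((D.c : ℚ) • lSeriesLog a)))
                  * PowerSeries.map (algebraMap ℚ ℂ) (W.formalExp.subst ((D.c : ℚ) • lSeriesLog a))
                - C (((X₀ / (D.c : ℚ) ^ 2 - W.b₂ / 12 : ℚ) : ℂ))
                  * PowerSeries.map (algebraMap ℚ ℂ) (W.formalExp.subst ((D.c : ℚ) • lSeriesLog a)) ^ 3) := by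
  have hc : D.c ≠ 0 := D.maninConstant_ne_zero_holds
  have hcC : (D.c : ℂ) ≠ 0 := by exact_mod_cast hc
  set φ := algebraMap ℚ ℂ with hφ
  obtain ⟨R, hR0, hR⟩ := exists_rhoInv W hc a hz
  have hz1 : coeff 1 z = 1 := MinimalCubeRoot.coeff_one_shortGerm W D a ha hz
  have hzne : PowerSeries.map φ z ≠ 0 := fun h0 ↦ by
    have := congrArg (coeff 1) h0
    rw [coeff_map, hz1, map_one, map_zero] at this
    exact one_ne_zero this
  have hRC : C (D.c : ℂ) * PowerSeries.map φ z * PowerSeries.map φ R = PowerSeries.map φ (W.formalExp.subst ((D.c : ℚ) • lSeriesLog a)) := by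
    have := congrArg (PowerSeries.map φ) hR
    rw [map_mul, map_mul, PowerSeries.map_C, hφ, eq_ratCast] at this
    exact_mod_cast this
  have hcube := kummerCubeSeriesC_mul_cube_eq W hc a hz X₀ Y₀
  refine ⟨R, hR0, hR, ?_, ?_, ?_⟩
  · rw [map_mul, ← coeff_zero_eq_constantCoeff_apply, coeff_map, coeff_zero_eq_constantCoeff_apply, hR0, map_one, one_mul, hh0]
  · rw [smul_eq_C_mul, ← hRC]; ring
  · have hcz0 : (C (D.c : ℂ) * PowerSeries.map φ z) ^ 3 ≠ 0 := by
      refine pow_ne_zero 3 (mul_ne_zero ?_ hzne)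
      intro h0; apply hcC; simpa using congrArg constantCoeff h0
    refine mul_left_cancel₀ hcz0 ?_
    rw [← hcube, ← hh3, ← hRC]
    ring

end Summit.BirchSwinnertonDyer.BirchSwinnertonDyer.Theorems.ManinLocalTwoThree.MinimalCubeRootC

end
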